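import Mathlib
import HarnessLib
import Summits.HubbardSuperconductivity.HubbardSuperconductivity.Theorems.KLProgrammeKLRegimeStarConvolutionDiamWeight
import Summits.HubbardSuperconductivity.HubbardSuperconductivity.Theorems.KLProgrammeKLRegimeEngineE4ScaleDoor
import Summits.HubbardSuperconductivity.HubbardSuperconductivity.Theorems.KLProgrammeKLRegimeEngineScaleZeroE4TorusSums

/-!
# K3 ENGINE child (stmt-HubbardSuperconductivity-20437), stub (b) conjunct 3 ((E4)ₙ supply, part (i)): the star-convolution bound AT THE
# ENGINE'S WEIGHT — `klScaleWt L M β n = 1 + Λ_n·diam` on the `4M`-grid positions `ZMod (4M) × (ℤ/L)²`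

Cell gate-hubbard-kl, seat hubbard-kl-k3c3-p2 (g7).  `…StarConvolutionDiamWeight.sum_diamWeight_mul_norm_starConv_le` is stated for any finite abelian
group with a translation-invariant label pseudo-distance; this file instantiates it on the position group of the engine's decay bookkeeping
(`…ScaleZeroE4Defs`, `…EngineE4ScaleDoor` §1): positions `ZMod (2·(2·M)) × TorusSite 2 L`, distance `gridLabelDist L (4M) β`, weight `klScaleWt L M β n`.

* `gridLabelDist_eq_sub_zero` — translation invariance: `d(a, b) = d(a − b, 0)`;
* `isLabelDist_gridLabelDist_sub` — `(a, b) ↦ d(a − b, 0)` is a label pseudo-distance (`β ≥ 0`);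
* `klScaleWt_eq_one_add_mul_labelDiam_sub` — `klScaleWt L M β n S = 1 + Λ_n · diam_{d(·−·,0)} S`;
* **`sum_klScaleWt_mul_norm_starConv_le`** — for leg kernels `f₀, …, f_k` on the grid group and leg `0` pinned at `x₀`:
  `Σ_{x : Fin k → grid} klScaleWt_n(image (x₀ :: x)) · ‖Σ_y Π_i f_i((x₀ :: x) i − y)‖ ≤ Π_i Σ_z (1 + Λ_n·d(z,0))·‖f_i z‖`
  (the `klScaleWt n`-weighted per-tuple sum of a smeared local vertex is at most the product of the weighted torus sums of its legs — the shape W1 supplies).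

Pure bookkeeping; nothing about the model is asserted.
-/

noncomputable section

open Finset

namespace Summit.HubbardSuperconductivity.HubbardSuperconductivity.Theorems.EngineV8

set_option linter.dupNamespace false -- summit = problem name (single-conjunct summit), D-0017

open Literature.MathematicalPhysics.QuantumLattice Literature.Probability.LatticeModels Literature.Probability.LatticeModels.BattleFederbush
open Summit.HubbardSuperconductivity.HubbardSuperconductivity.Theorems.KLRegimeSplit
open Summit.HubbardSuperconductivity.HubbardSuperconductivity.Theorems.KLProgrammeLegKernels

variable {L Ng : ℕ}

/-- **Translation invariance of the grid label distance**: `gridLabelDist a b = gridLabelDist (a − b) 0`. -/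
theorem gridLabelDist_eq_sub_zero (β : ℝ) (a b : ZMod Ng × TorusSite 2 L) :
    gridLabelDist L Ng β a b = gridLabelDist L Ng β (a - b) 0 := by
  rw [gridLabelDist_apply, gridLabelDist_apply, cyclicDist_eq_sub_zero Ng a.1, torusSiteDist_eq_sub_zero a.2]
  rfl

/-- **`(a, b) ↦ gridLabelDist (a − b) 0` is a label pseudo-distance** (`β ≥ 0`; it IS `gridLabelDist`). -/
theorem isLabelDist_gridLabelDist_sub [NeZero L] [NeZero Ng] {β : ℝ} (hβ : 0 ≤ β) :
    IsLabelDist (fun a b : ZMod Ng × TorusSite 2 L => gridLabelDist L Ng β (a - b) 0) := by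
  have h := isLabelDist_gridLabelDist L Ng hβ
  have e : (fun a b : ZMod Ng × TorusSite 2 L => gridLabelDist L Ng β (a - b) 0) = gridLabelDist L Ng β := by
    funext a b; rw [← gridLabelDist_eq_sub_zero]
  rw [e]; exact h

/-- `klScaleWt L M β n S = 1 + Λ_n · diam S` for the translation-invariant form of the distance. -/
theorem klScaleWt_eq_one_add_mul_labelDiam_sub (M : ℕ) (β : ℝ) (n : ℕ) (S : Finset (ZMod (2 * (2 * M)) × TorusSite 2 L)) :
    klScaleWt L M β n S = 1 + klScale klE0 n * labelDiam (fun a b : ZMod (2 * (2 * M)) × TorusSite 2 L =>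
      gridLabelDist L (2 * (2 * M)) β (a - b) 0) S := by
  have e : (fun a b : ZMod (2 * (2 * M)) × TorusSite 2 L => gridLabelDist L (2 * (2 * M)) β (a - b) 0) =
      gridLabelDist L (2 * (2 * M)) β := by
    funext a b; rw [← gridLabelDist_eq_sub_zero]
  rw [klScaleWt_apply, e]

/-- **The `klScaleWt n`-weighted per-tuple sum of a smeared local vertex factorises over its legs.**  On the grid group
`ZMod (2·(2·M)) × TorusSite 2 L`, for leg kernels `f₀, …, f_k` and leg `0` pinned at `x₀`:
`Σ_{x : Fin k → grid} klScaleWt L M β n (image (x₀ :: x)) · ‖Σ_y Π_i f_i((x₀ :: x) i − y)‖ ≤ Π_i Σ_z (1 + Λ_n · gridLabelDist z 0) · ‖f_i z‖`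
(`β ≥ 0`, `L, M ≠ 0`). -/
theorem sum_klScaleWt_mul_norm_starConv_le [NeZero L] {M : ℕ} [NeZero M] {β : ℝ} (hβ : 0 ≤ β) (n : ℕ) {k : ℕ}
    (f : Fin (k + 1) → ZMod (2 * (2 * M)) × TorusSite 2 L → ℂ) (x₀ : ZMod (2 * (2 * M)) × TorusSite 2 L) :
    ∑ x : Fin k → ZMod (2 * (2 * M)) × TorusSite 2 L,
        klScaleWt L M β n (univ.image (Matrix.vecCons x₀ x)) *
          ‖∑ y : ZMod (2 * (2 * M)) × TorusSite 2 L, ∏ i : Fin (k + 1), f i (Matrix.vecCons x₀ x i - y)‖ ≤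
      ∏ i : Fin (k + 1), ∑ z : ZMod (2 * (2 * M)) × TorusSite 2 L,
        (1 + klScale klE0 n * gridLabelDist L (2 * (2 * M)) β z 0) * ‖f i z‖ := by
  haveI : NeZero (2 * (2 * M)) := ⟨by have := NeZero.ne M; omega⟩
  have h := sum_diamWeight_mul_norm_starConv_le (P := ZMod (2 * (2 * M)) × TorusSite 2 L)
    (fun z => gridLabelDist L (2 * (2 * M)) β z 0) (isLabelDist_gridLabelDist_sub (L := L) (Ng := 2 * (2 * M)) hβ)
    (klth_klScale_pos n).le f x₀
  simp_rw [klScaleWt_eq_one_add_mul_labelDiam_sub]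
  exact h

end Summit.HubbardSuperconductivity.HubbardSuperconductivity.Theorems.EngineV8

end
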